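import Summits.HodgeConjecture.HodgeConjecture.Theorems.R90S4LocalBaseChangeDefs   -- ★ `GtLoc L v = GL (Fin 3) (UnitaryGroup.LocalRing L v)` (the §13.2 objects, FILE C defs)
import Literature.NumberTheory.Automorphic.UnitaryGroupLocalFactors                 -- ★ `localGLPiEquiv : GL_N(Π_w E_w) ≃ₜ* Π_w GL_N(E_w)`, `localIntBox`, `isOpen_localIntBox`, `isCompact_localIntBox`
import HarnessLib

/-!
# R90-TF · S4 · THEOREMS — `R90S4GtLocCompactOpen` (W3-5 «K-GT»): `G̃_v = GL₃(L ⊗ L⁺_v)` has a compact open subgroup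

R90-TF section S4 = [Rogawski1990] Ch. 13.1–13.2 (dealer K2E2-plan (g6)); crux H413 (`stmt-HodgeConjecture-24833`), route
`HCCMUnconditional`; brick (W3-5) of DEAL WAVE S4-W3 (R90 bus 2026-09-04T21:35:33Z ∕ 21:44:00Z), pen K2E3-p12 (g9).

WHAT IS PROVED (one theorem, no `sorry`, no `def`, no instance): `exists_isOpen_isCompact_subgroup_gtLoc` — the local group
`G̃_v = GtLoc L v = GL₃(E_v)`, `E_v = L ⊗_{L⁺} L⁺_v = Π_{w ∣ v} L_w` (★ `UnitaryGroup.LocalRing`), has a subgroup that is both OPEN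
and COMPACT, namely `GL₃(𝒪_v) := Π_{w ∣ v} GL₃(𝒪_w)` pulled back along the topological-group isomorphism
`GL₃(Π_w L_w) ≃ₜ* Π_w GL₃(L_w)` (★ `UnitaryGroup.localGLPiEquiv`; the box ★ `UnitaryGroup.localIntBox` is open and compact by ★
`isOpen_localIntBox` ∕ ★ `isCompact_localIntBox`, i.e. by the compactness and openness of each `GL₃(𝒪_w) ≤ GL₃(L_w)`).  This is the
`hKo ∕ hKc` input (a level `K ≤ G̃_v`) of the heads of ★ `Theorems/R90S4LiftInjectiveOfLinIndep` (W3-2, `mem_eq_of_lifts`) and of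
★ `Theorems/R90S4TwistedCharLiftLemmas` (twisted characters through a level), consumed by the Lines file C ED. 2
(`Cruxes/H413/Lines/R90_S4_LocalBaseChangeC.lean`, payment of S4#C3).  [PlatonovRapinchuk1994, §5.1: `G_{𝒪_v}` is a compact open
subgroup of `G_{F_v}` for any matrix realisation; Rogawski1990 §3.11 p. 34: `G̃ = Res_{E/F} GL₃`.]

HONEST LABEL: HC_CM is proved only modulo the 7 printed citations (2 remaining named inputs: hLiu418 = stmt-HodgeConjecture-24832,
h413 = stmt-HodgeConjecture-24833) until rung 0 closes; this brick is unconditional and discharges nothing by itself.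

## References
* [Rogawski1990] J. D. Rogawski, *Automorphic Representations of Unitary Groups in Three Variables*, Ann. of Math. Stud. 123 (1990),
  §3.11 p. 34 (`G̃`), §13.2 pp. 199–201.
* [PlatonovRapinchuk1994] V. Platonov, A. Rapinchuk, *Algebraic Groups and Number Theory* (1994), §5.1 (`G_{𝒪_v}` compact open).
-/

set_option autoImplicit false
set_option linter.dupNamespace false

noncomputable section

open scoped NumberField

namespace Summit.HodgeConjecture.HodgeConjecture.R90.S4

open Literature.NumberTheory.Automorphic
open IsDedekindDomain NumberField

variable (L : Type) [Field L] [NumberField L] (v : HeightOneSpectrum (𝓞 ↥(maximalRealSubfield L)))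

/-- **`G̃_v = GL₃(L ⊗ L⁺_v)` has a compact open subgroup** — `GL₃(𝒪_v) = Π_{w ∣ v} GL₃(𝒪_w)`, the pull-back of the box
★ `UnitaryGroup.localIntBox L 3 v ≤ Π_{w ∣ v} GL₃(L_w)` along ★ `UnitaryGroup.localGLPiEquiv L 3 v : GL₃(Π_w L_w) ≃ₜ* Π_w GL₃(L_w)`;
open as the continuous preimage of an open subgroup, compact as the preimage of a compact set under a homeomorphism.
(`[IsCMField L]` is not needed: `GtLoc L v` only uses the subfield `L⁺ = maximalRealSubfield L`; consumers with the CM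
instance in scope apply it verbatim as `exists_isOpen_isCompact_subgroup_gtLoc L v`.)
[cite: PlatonovRapinchuk1994, §5.1] [cite: Rogawski1990, §3.11 p. 34] -/
theorem exists_isOpen_isCompact_subgroup_gtLoc :
    ∃ K : Subgroup (GtLoc L v), IsOpen (K : Set (GtLoc L v)) ∧ IsCompact (K : Set (GtLoc L v)) := by
  refine ⟨(UnitaryGroup.localIntBox L 3 v).comap (UnitaryGroup.localGLPiEquiv L 3 v).toMonoidHom, ?_, ?_⟩
  · exact (UnitaryGroup.isOpen_localIntBox L 3 v).preimage (UnitaryGroup.localGLPiEquiv L 3 v).continuous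
  · exact ((UnitaryGroup.localGLPiEquiv L 3 v).toHomeomorph.isCompact_preimage).2
      (UnitaryGroup.isCompact_localIntBox L 3 v)

end Summit.HodgeConjecture.HodgeConjecture.R90.S4

end
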